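import Mathlib
import HarnessLib
import Summits.CriticalPhenomena.SAWScalingLimit.Theses.SAWDefectDecoherence

/-!
# Ideator1Sketch (published copy) — crux-ideate stmt-CriticalPhenomena-14004 (BoundaryClosureR), ideator 1, round 1

First-lemma signatures for the crux idea cards
`Ideas/runge-gated-green-pairing.md` and `Ideas/sector-bootstrap.md`.
Nothing is proved here; every `def … : Prop` elaborates over existing declarations.
-/

namespace Summit.CriticalPhenomena.SAWScalingLimit.Cruxes.BoundaryClosureR.Ideator1Sketch

open scoped BigOperators ComplexConjugate
open Filter Set MeasureTheory
open Literature.Probability.LatticeModels Literature.Probability.RandomPlanarGeometry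
open Literature.Probability.RandomPlanarGeometry.SAW
open Summit.CriticalPhenomena.SAWScalingLimit.Theses.SAWDefectDecoherence

/-- CARD runge-gated-green-pairing, FIRST LEMMA (exact, provable now from DCS Lemma 1 =
`DuminilCopinSmirnov2012_lemma1_holds`): the **weighted discrete Green identity**. Multiply the vertex
relation at `v` by an arbitrary vertex weight `u v` and sum over `v ∈ Λ`; every interior edge `{v,w}`
appears twice, with `mid − c_v = (c_w − c_v)/2` and `mid − c_w = −(c_w − c_v)/2`, so the interior part
becomes `(1/4) Σ_v Σ_{w ∈ Λ, w ∼ v} (c_w − c_v)(u v − u w) F{v,w}` (a discrete `∬ F ∂̄u`-pairing plus the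
`u_e²`-twisted pairing), while every boundary mid-edge appears once, weighted by `u` at its inside
vertex (the discrete `∮ u F dz`).  With `u ≡ 1` this is DCS's eq. (2) / `HexGreen.sum_relations_eq_hexFlux`. -/
def WeightedGreenIdentity : Prop :=
  ∀ (Λ : Finset HexVertex), hexDomainSimplyConnected Λ → ∀ a ∈ hexDomainBoundary Λ,
    ∀ u : HexVertex → ℂ,
      let F : Sym2 HexVertex → ℂ := hexParafermionicObservable Λ a hexCriticalFugacity (5 / 8)
      (∑ v ∈ Λ, ∑ w ∈ Λ.filter (fun w => hexGraph.Adj v w),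
          (hexCenter w - hexCenter v) * (u v - u w) * F s(v, w)) +
        4 * ∑ v ∈ Λ, u v * ∑ᶠ w ∈ {w : HexVertex | hexGraph.Adj v w ∧ w ∉ Λ},
          (hexMidpoint s(v, w) - hexCenter v) * F s(v, w) = 0

/-- CARD runge-gated-green-pairing, the pure-analysis tool (classical Runge theorem, polynomial form;
not in Mathlib): a function holomorphic near a compact set with connected complement is a uniform limit
of polynomials on it.  Used with `K` = a closed two-sided neighbourhood of `∂Ω` minus the flat gate at `b`
and `f = −Tψ` (the Cauchy transform of the bulk test function, holomorphic off `supp ψ`). -/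
def RungePolynomial : Prop :=
  ∀ (K : Set ℂ), IsCompact K → IsPreconnected Kᶜ → ∀ (U : Set ℂ), IsOpen U → K ⊆ U →
    ∀ f : ℂ → ℂ, DifferentiableOn ℂ f U → ∀ ε : ℝ, 0 < ε →
      ∃ p : Polynomial ℂ, ∀ z ∈ K, ‖f z - p.eval z‖ < ε

/-- CARD runge-gated-green-pairing, the load-bearing INPUT `FlatGateProfile` (σ = 0, one edge class,
positive masses): in the frame of the repaired target `HexObservableLimitR` (flat horizontal pieces and
exact half-lattice in the `ρ`-balls at BOTH marked points), the `Z(b_δ)`-normalised arrival measure of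
the flat gate at `b`, `α^b_δ := δ · Σ_{e ∈ ∂Λ_δ, δ·mid e ∈ B(b,ρ)} (Z_δ(e)/Z_δ(b_δ)) · δ_{δ·mid e}`
(`Z_δ = F_{x_c,0}`), converges weakly to the conformal boundary density
`(Φ'(x)/Φ'(b))^{5/8} dx = exp((5/8)(L − L_b)) dx` on the gate (the dangling edges of a zigzag row are
spaced `1` apart in lattice units, whence no extra constant).  `Lbar` is any continuous extension of
`L = log Φ'` to the gate (it exists by Schwarz reflection across the flat piece). -/
def FlatGateProfile : Prop :=
  ∀ (D : DobrushinDomain) (ρ : ℝ) (Λ : ℝ → Finset HexVertex) (m : Fin 2 → ℝ → ℤ)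
    (a b : ℝ → Sym2 HexVertex) (Φ : ConformalEquiv D.carrier UpperHalfPlane.upperHalfPlaneSet)
    (L : ℂ → ℂ) (Lb : ℂ) (Lbar : ℂ → ℂ) (g : ℂ → ℂ),
    let Z : ℝ → Sym2 HexVertex → ℂ := fun δ z =>
      hexParafermionicObservable (Λ δ) (a δ) hexCriticalFugacity 0 z
    let gate : Set ℂ := {z : ℂ | z.im = (D.pt 1).im} ∩ Metric.ball (D.pt 1) ρ
    0 < ρ →
    (∀ i : Fin 2, D.carrier ∩ Metric.ball (D.pt i) ρ =
        {z : ℂ | (D.pt i).im < z.im} ∩ Metric.ball (D.pt i) ρ) →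
    (∀ᶠ δ : ℝ in nhdsWithin 0 (Set.Ioi 0),
        hexDomainSimplyConnected (Λ δ) ∧ a δ ∈ hexDomainBoundary (Λ δ) ∧
          b δ ∈ hexDomainBoundary (Λ δ) ∧ Nonempty (HexMidEdgeSAW (Λ δ) (a δ) (b δ)) ∧
          (hexGraph.induce ((Λ δ : Finset HexVertex) : Set HexVertex)).Preconnected ∧
          (∀ v ∈ Λ δ, (δ : ℂ) * hexCenter v ∈ D.carrier) ∧
          (∀ i : Fin 2, ∀ v : HexVertex, (δ : ℂ) * hexCenter v ∈ Metric.ball (D.pt i) ρ →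
            (v ∈ Λ δ ↔ m i δ ≤ v.1 1))) →
    (∀ K : Set ℂ, IsCompact K → K ⊆ D.carrier → ∀ᶠ δ : ℝ in nhdsWithin 0 (Set.Ioi 0),
        ∀ v : HexVertex, (δ : ℂ) * hexCenter v ∈ K → v ∈ Λ δ) →
    Tendsto (fun δ : ℝ => (δ : ℂ) * hexMidpoint (a δ)) (nhdsWithin 0 (Set.Ioi 0)) (nhds (D.pt 0)) →
    Tendsto (fun δ : ℝ => (δ : ℂ) * hexMidpoint (b δ)) (nhdsWithin 0 (Set.Ioi 0)) (nhds (D.pt 1)) →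
    Tendsto (fun x => ‖Φ x‖) (nhdsWithin (D.pt 0) D.carrier) atTop →
    Φ.HasBoundaryValue (D.pt 1) 0 →
    ContinuousOn L D.carrier → (∀ z ∈ D.carrier, Complex.exp (L z) = deriv Φ z) →
    Tendsto L (nhdsWithin (D.pt 1) D.carrier) (nhds Lb) →
    ContinuousOn Lbar (D.carrier ∪ gate) → EqOn Lbar L D.carrier →
    Continuous g → HasCompactSupport g → tsupport g ⊆ Metric.ball (D.pt 1) ρ →
    Tendsto (fun δ : ℝ => (δ : ℂ) *
        ∑ᶠ e ∈ {e : Sym2 HexVertex | e ∈ hexDomainBoundary (Λ δ) ∧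
            (δ : ℂ) * hexMidpoint e ∈ Metric.ball (D.pt 1) ρ},
          g ((δ : ℂ) * hexMidpoint e) * (Z δ e / Z δ (b δ)))
      (nhdsWithin 0 (Set.Ioi 0))
      (nhds (∫ x in Set.Ioo ((D.pt 1).re - ρ) ((D.pt 1).re + ρ),
        g ((x : ℂ) + ((D.pt 1).im : ℂ) * Complex.I) *
          Complex.exp ((5 / 8 : ℂ) * (Lbar ((x : ℂ) + ((D.pt 1).im : ℂ) * Complex.I) - Lb))))

/-- CARD sector-bootstrap, the load-bearing INPUT `PhaseSectorInMass` (phase-only): there are a universal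
half-angle `γ < π/2` and a universal unimodular `u₀` such that, in the frame of the repaired target, the
STAR AVERAGE `A_δ(v) := (1/3) Σ_{t ∼ v} F_δ{v,t}` at black vertices `v` (the coherent mode; the vertex
relation kills the third Fourier mode of the star exactly and DefectDecoherence bounds the second),
corrected by the conformal phase `exp(−(5/8)(L(δ c_v) − L_b))` and by the phase of `F_δ(b_δ)`, lies in
the sector `{|arg| ≤ γ}` up to an `|A|`-mass that is negligible against `|F_δ(b_δ)|` on every compact subset
of `Ω ∪ (open flat gate at b)` (compacts may touch the exact flat row, where the phase is EXACTLY right):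
`δ² Σ_{v black, δc_v ∈ K} [cos γ · |A_δ(v)| − Re(u₀ e^{−(5/8)(L − L_b)} A_δ(v) conj F_δ(b_δ)/|F_δ(b_δ)|)]₊
 / |F_δ(b_δ)| → 0`.  Implied by the pointwise form of DCS Conjecture 2; carries NO modulus information. -/
def PhaseSectorInMass : Prop :=
  ∃ γ : ℝ, γ < Real.pi / 2 ∧ ∃ u₀ : ℂ, ‖u₀‖ = 1 ∧
  ∀ (D : DobrushinDomain) (ρ : ℝ) (Λ : ℝ → Finset HexVertex) (m : Fin 2 → ℝ → ℤ)
    (a b : ℝ → Sym2 HexVertex) (Φ : ConformalEquiv D.carrier UpperHalfPlane.upperHalfPlaneSet)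
    (L : ℂ → ℂ) (Lb : ℂ),
    let F : ℝ → Sym2 HexVertex → ℂ := fun δ z =>
      hexParafermionicObservable (Λ δ) (a δ) hexCriticalFugacity (5 / 8) z
    let A : ℝ → HexVertex → ℂ := fun δ v =>
      (1 / 3 : ℂ) * ∑ᶠ t ∈ {t : HexVertex | hexGraph.Adj v t}, F δ s(v, t)
    0 < ρ →
    (∀ i : Fin 2, D.carrier ∩ Metric.ball (D.pt i) ρ =
        {z : ℂ | (D.pt i).im < z.im} ∩ Metric.ball (D.pt i) ρ) →
    (∀ᶠ δ : ℝ in nhdsWithin 0 (Set.Ioi 0),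
        hexDomainSimplyConnected (Λ δ) ∧ a δ ∈ hexDomainBoundary (Λ δ) ∧
          b δ ∈ hexDomainBoundary (Λ δ) ∧ Nonempty (HexMidEdgeSAW (Λ δ) (a δ) (b δ)) ∧
          (hexGraph.induce ((Λ δ : Finset HexVertex) : Set HexVertex)).Preconnected ∧
          (∀ v ∈ Λ δ, (δ : ℂ) * hexCenter v ∈ D.carrier) ∧
          (∀ i : Fin 2, ∀ v : HexVertex, (δ : ℂ) * hexCenter v ∈ Metric.ball (D.pt i) ρ →
            (v ∈ Λ δ ↔ m i δ ≤ v.1 1))) →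
    (∀ K : Set ℂ, IsCompact K → K ⊆ D.carrier → ∀ᶠ δ : ℝ in nhdsWithin 0 (Set.Ioi 0),
        ∀ v : HexVertex, (δ : ℂ) * hexCenter v ∈ K → v ∈ Λ δ) →
    Tendsto (fun δ : ℝ => (δ : ℂ) * hexMidpoint (a δ)) (nhdsWithin 0 (Set.Ioi 0)) (nhds (D.pt 0)) →
    Tendsto (fun δ : ℝ => (δ : ℂ) * hexMidpoint (b δ)) (nhdsWithin 0 (Set.Ioi 0)) (nhds (D.pt 1)) →
    Tendsto (fun x => ‖Φ x‖) (nhdsWithin (D.pt 0) D.carrier) atTop →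
    Φ.HasBoundaryValue (D.pt 1) 0 →
    ContinuousOn L D.carrier → (∀ z ∈ D.carrier, Complex.exp (L z) = deriv Φ z) →
    Tendsto L (nhdsWithin (D.pt 1) D.carrier) (nhds Lb) →
    ∀ K : Set ℂ, IsCompact K →
      K ⊆ D.carrier ∪ ({z : ℂ | z.im = (D.pt 1).im} ∩ Metric.ball (D.pt 1) ρ) →
      Tendsto (fun δ : ℝ => δ ^ 2 *
          (∑ᶠ v ∈ {v : HexVertex | v ∈ Λ δ ∧ v.2 = 0 ∧ (δ : ℂ) * hexCenter v ∈ K},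
            max 0 (Real.cos γ * ‖A δ v‖ -
              (u₀ * Complex.exp (-(5 / 8 : ℂ) * (L ((δ : ℂ) * hexCenter v) - Lb)) * A δ v *
                  conj (F δ (b δ)) / (‖F δ (b δ)‖ : ℂ)).re)) / ‖F δ (b δ)‖)
        (nhdsWithin 0 (Set.Ioi 0)) (nhds 0)

/-- CARDS runge-gated-green-pairing (input) / sector-bootstrap (output): `GateL1Bound`, the local L¹
a-priori bound on the `F_δ(b_δ)`-normalised observable on every compact subset of `Ω ∪ (open flat gate at b)`.
On compacts of `Ω` it is forced by the target itself (Banach–Steinhaus) and equals WindingAlias's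
`NormalisedMassBound` restricted to compacts; the extension to compacts touching the exact flat row at `b` is
what the cutoff bands of the gated Green identity consume. -/
def GateL1Bound : Prop :=
  ∀ (D : DobrushinDomain) (ρ : ℝ) (Λ : ℝ → Finset HexVertex) (m : Fin 2 → ℝ → ℤ)
    (a b : ℝ → Sym2 HexVertex),
    let F : ℝ → Sym2 HexVertex → ℂ := fun δ z =>
      hexParafermionicObservable (Λ δ) (a δ) hexCriticalFugacity (5 / 8) z
    0 < ρ →
    (∀ i : Fin 2, D.carrier ∩ Metric.ball (D.pt i) ρ =
        {z : ℂ | (D.pt i).im < z.im} ∩ Metric.ball (D.pt i) ρ) →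
    (∀ᶠ δ : ℝ in nhdsWithin 0 (Set.Ioi 0),
        hexDomainSimplyConnected (Λ δ) ∧ a δ ∈ hexDomainBoundary (Λ δ) ∧
          b δ ∈ hexDomainBoundary (Λ δ) ∧ Nonempty (HexMidEdgeSAW (Λ δ) (a δ) (b δ)) ∧
          (hexGraph.induce ((Λ δ : Finset HexVertex) : Set HexVertex)).Preconnected ∧
          (∀ v ∈ Λ δ, (δ : ℂ) * hexCenter v ∈ D.carrier) ∧
          (∀ i : Fin 2, ∀ v : HexVertex, (δ : ℂ) * hexCenter v ∈ Metric.ball (D.pt i) ρ →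
            (v ∈ Λ δ ↔ m i δ ≤ v.1 1))) →
    (∀ K : Set ℂ, IsCompact K → K ⊆ D.carrier → ∀ᶠ δ : ℝ in nhdsWithin 0 (Set.Ioi 0),
        ∀ v : HexVertex, (δ : ℂ) * hexCenter v ∈ K → v ∈ Λ δ) →
    Tendsto (fun δ : ℝ => (δ : ℂ) * hexMidpoint (a δ)) (nhdsWithin 0 (Set.Ioi 0)) (nhds (D.pt 0)) →
    Tendsto (fun δ : ℝ => (δ : ℂ) * hexMidpoint (b δ)) (nhdsWithin 0 (Set.Ioi 0)) (nhds (D.pt 1)) →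
    ∀ K : Set ℂ, IsCompact K →
      K ⊆ D.carrier ∪ ({z : ℂ | z.im = (D.pt 1).im} ∩ Metric.ball (D.pt 1) ρ) →
      ∃ C : ℝ, ∀ᶠ δ : ℝ in nhdsWithin 0 (Set.Ioi 0),
        δ ^ 2 * (∑ᶠ e ∈ {e : Sym2 HexVertex | e ∈ hexDomainMidEdges (Λ δ) ∧
            (δ : ℂ) * hexMidpoint e ∈ K}, ‖F δ e‖) ≤ C * ‖F δ (b δ)‖

/-- CARDS runge-gated-green-pairing / sector-bootstrap, positive-mass input `GateMassGrowth` (σ = 0): above the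
exact flat row at `b` the arrival mass grows into the bulk at most like `k^{3/4}` (predicted `k^{25/48}`): for
every lattice height `k ≥ 1`, the total `Z`-mass of the vertex stars on row `m 1 δ + k` inside `B(b, ρ/2)` is at
most `C k^{3/4}` times the total arrival mass of the dangling edges of the row inside `B(b, ρ)`.  With
DefectDecoherence (any `θ > 3/4`) this makes the gate-layer twisted sums `O(δ^{θ-3/4})` with NO bound on `|F|`. -/
def GateMassGrowth : Prop :=
  ∃ C : ℝ, ∀ (D : DobrushinDomain) (ρ : ℝ) (Λ : ℝ → Finset HexVertex) (m : Fin 2 → ℝ → ℤ)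
    (a b : ℝ → Sym2 HexVertex),
    let Z : ℝ → Sym2 HexVertex → ℂ := fun δ z =>
      hexParafermionicObservable (Λ δ) (a δ) hexCriticalFugacity 0 z
    0 < ρ →
    (∀ i : Fin 2, D.carrier ∩ Metric.ball (D.pt i) ρ =
        {z : ℂ | (D.pt i).im < z.im} ∩ Metric.ball (D.pt i) ρ) →
    (∀ᶠ δ : ℝ in nhdsWithin 0 (Set.Ioi 0),
        hexDomainSimplyConnected (Λ δ) ∧ a δ ∈ hexDomainBoundary (Λ δ) ∧
          b δ ∈ hexDomainBoundary (Λ δ) ∧ Nonempty (HexMidEdgeSAW (Λ δ) (a δ) (b δ)) ∧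
          (hexGraph.induce ((Λ δ : Finset HexVertex) : Set HexVertex)).Preconnected ∧
          (∀ v ∈ Λ δ, (δ : ℂ) * hexCenter v ∈ D.carrier) ∧
          (∀ i : Fin 2, ∀ v : HexVertex, (δ : ℂ) * hexCenter v ∈ Metric.ball (D.pt i) ρ →
            (v ∈ Λ δ ↔ m i δ ≤ v.1 1))) →
    (∀ K : Set ℂ, IsCompact K → K ⊆ D.carrier → ∀ᶠ δ : ℝ in nhdsWithin 0 (Set.Ioi 0),
        ∀ v : HexVertex, (δ : ℂ) * hexCenter v ∈ K → v ∈ Λ δ) →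
    Tendsto (fun δ : ℝ => (δ : ℂ) * hexMidpoint (a δ)) (nhdsWithin 0 (Set.Ioi 0)) (nhds (D.pt 0)) →
    Tendsto (fun δ : ℝ => (δ : ℂ) * hexMidpoint (b δ)) (nhdsWithin 0 (Set.Ioi 0)) (nhds (D.pt 1)) →
    ∀ᶠ δ : ℝ in nhdsWithin 0 (Set.Ioi 0), ∀ k : ℕ, 1 ≤ k →
      (∑ᶠ v ∈ {v : HexVertex | v ∈ Λ δ ∧ v.1 1 = m 1 δ + k ∧
          (δ : ℂ) * hexCenter v ∈ Metric.ball (D.pt 1) (ρ / 2)},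
        ∑ᶠ t ∈ {t : HexVertex | hexGraph.Adj v t}, ‖Z δ s(v, t)‖) ≤
      C * (k : ℝ) ^ (3 / 4 : ℝ) *
        ∑ᶠ e ∈ {e : Sym2 HexVertex | e ∈ hexDomainBoundary (Λ δ) ∧
            (δ : ℂ) * hexMidpoint e ∈ Metric.ball (D.pt 1) ρ}, ‖Z δ e‖

/-- CARD sector-bootstrap, the positive-mass budget it consumes on the gate (`FlatGateBudget`, a
one-sided boundary Harnack comparability on the exact flat half-lattice piece at `b`): the
`Z(b_δ)`-normalised arrival mass of the flat gate is eventually bounded. -/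
def FlatGateBudget : Prop :=
  ∀ (D : DobrushinDomain) (ρ : ℝ) (Λ : ℝ → Finset HexVertex) (m : Fin 2 → ℝ → ℤ)
    (a b : ℝ → Sym2 HexVertex),
    let Z : ℝ → Sym2 HexVertex → ℂ := fun δ z =>
      hexParafermionicObservable (Λ δ) (a δ) hexCriticalFugacity 0 z
    0 < ρ →
    (∀ i : Fin 2, D.carrier ∩ Metric.ball (D.pt i) ρ =
        {z : ℂ | (D.pt i).im < z.im} ∩ Metric.ball (D.pt i) ρ) →
    (∀ᶠ δ : ℝ in nhdsWithin 0 (Set.Ioi 0),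
        hexDomainSimplyConnected (Λ δ) ∧ a δ ∈ hexDomainBoundary (Λ δ) ∧
          b δ ∈ hexDomainBoundary (Λ δ) ∧ Nonempty (HexMidEdgeSAW (Λ δ) (a δ) (b δ)) ∧
          (hexGraph.induce ((Λ δ : Finset HexVertex) : Set HexVertex)).Preconnected ∧
          (∀ v ∈ Λ δ, (δ : ℂ) * hexCenter v ∈ D.carrier) ∧
          (∀ i : Fin 2, ∀ v : HexVertex, (δ : ℂ) * hexCenter v ∈ Metric.ball (D.pt i) ρ →
            (v ∈ Λ δ ↔ m i δ ≤ v.1 1))) →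
    (∀ K : Set ℂ, IsCompact K → K ⊆ D.carrier → ∀ᶠ δ : ℝ in nhdsWithin 0 (Set.Ioi 0),
        ∀ v : HexVertex, (δ : ℂ) * hexCenter v ∈ K → v ∈ Λ δ) →
    Tendsto (fun δ : ℝ => (δ : ℂ) * hexMidpoint (a δ)) (nhdsWithin 0 (Set.Ioi 0)) (nhds (D.pt 0)) →
    Tendsto (fun δ : ℝ => (δ : ℂ) * hexMidpoint (b δ)) (nhdsWithin 0 (Set.Ioi 0)) (nhds (D.pt 1)) →
    ∃ C : ℝ, ∀ᶠ δ : ℝ in nhdsWithin 0 (Set.Ioi 0),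
      δ * (∑ᶠ e ∈ {e : Sym2 HexVertex | e ∈ hexDomainBoundary (Λ δ) ∧
            (δ : ℂ) * hexMidpoint e ∈ Metric.ball (D.pt 1) ρ}, ‖Z δ e‖) ≤ C * ‖Z δ (b δ)‖

end Summit.CriticalPhenomena.SAWScalingLimit.Cruxes.BoundaryClosureR.Ideator1Sketch
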